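import Summits.KontsevichZagierPeriods.KontsevichZagierPeriods.Theorems.SymplecticScissorsVolumeFormOffPlaneToricD

/-!
# Toric assembly, part E: Hilbert's third problem for log-boxes at log-rank two

Helper file for the stub `stub_toricAssembly` of the line `Sketch` (card `log-polytope-hilbert-three`)
of the crux `VolumeFormOffPlane` (stmt-KontsevichZagierPeriods-14935), route `SymplecticScissors`.

`toric_core`: for real algebraic `α, β > 1`, multiplicatively independent, two finite families
of log-boxes with corners in `α^ℤ β^ℤ` and equal total value are KZ-equivalent as formal sums —
under the six hypotheses of the stub (existence, cut, scaling, permutation, value,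
Gelfond–Schneider), each stated verbatim as registered. Mechanism: normalise each box to an
origin box by a diagonal scaling (part A); expand it in the unit boxes (parts B, C); collect
unit boxes by letter count (part D); the total class is `∑_k C_k • W_k` and the total value is
`∑_k C_k (log α)^k (log β)^{n-k}` with the SAME integers `C_k`; equal values force equal `C_k`
(rank-two log-independence), hence equal classes. `toric_rtb` removes `α, β > 1` by the
inversions `α ↦ α⁻¹`, `β ↦ β⁻¹`; `stub_toricAssembly` is the registered stub, verbatim.
-/

noncomputable section

open MeasureTheory Set
open Literature.NumberTheory.Transcendental

namespace Summit.KontsevichZagierPeriods.SymplecticScissors.LogPolytope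

-- Shorthands used in the SOURCE of this file (work/toric/ToricE.src.lean, expanded by
-- work/toric/pp.py before checking/landing; the landed file is notation-free):
--   𝔅(n, a, b)  = the log-box;  𝔅₁(n, c) = 𝔅(n, fun _ => 1, c);  π = QuotientAddGroup.mk' KZ.relations
--   HExists / HCut / HScale / HPerm / HValue / HGS = the registered stub statements (verbatim);
--   REST(n, a, b) = the conclusion of the sector statement for fixed dimension n and base (a, b);
--   RTB = the registered conclusion of `stub_toricAssembly`.

/-! ## Corner arithmetic -/

/-- Quotient of two corners in `α^ℤ β^ℤ`. [folklore] -/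
theorem toric_corner_div : ∀ {α β : ℝ}, 0 < α → 0 < β → ∀ (u v u₁ v₁ : ℤ), (α ^ u * β ^ v)⁻¹ * (α ^ u₁ * β ^ v₁) = α ^ (u₁ - u) * β ^ (v₁ - v) := by
  intro α β hα hβ u v u₁ v₁
  rw [zpow_sub₀ hα.ne', zpow_sub₀ hβ.ne', mul_inv]
  ring

/-- A non-empty edge `α^u β^v < α^{u₁} β^{v₁}` means `1 < α^{u₁-u} β^{v₁-v}`. [folklore] -/
theorem toric_one_lt_corner_div {α β : ℝ} (hα : 0 < α) (hβ : 0 < β) {u v u₁ v₁ : ℤ}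
    (h : α ^ u * β ^ v < α ^ u₁ * β ^ v₁) : 1 < α ^ (u₁ - u) * β ^ (v₁ - v) := by
  have h0 : 0 < α ^ u * β ^ v := mul_pos (zpow_pos hα _) (zpow_pos hβ _)
  rw [← toric_corner_div hα hβ, ← div_eq_inv_mul, one_lt_div h0]
  exact h

/-! ## The core: both bases `> 1` -/

/-- **Log-boxes at log-rank two, bases `> 1`.** See the module docstring. [folklore] -/
theorem toric_core (hEx : (∀ (n : ℕ) (a b : Fin n → ℝ), (∀ j, 0 < a j) → (∀ j, IsAlgebraic ℚ (a j)) → (∀ j, IsAlgebraic ℚ (b j)) → ∃ r : KZ.IntegralRep (n + 1), r.domain = {p : Fin (n + 1) → ℝ | (∀ j : Fin n, a j < p (Fin.castSucc j) ∧ p (Fin.castSucc j) < b j) ∧ 0 < p (Fin.last n) ∧ p (Fin.last n) * ∏ j : Fin n, p (Fin.castSucc j) < 1} ∧ r.integrand = fun _ => 1)) (hCut : (∀ (n : ℕ) (a b : Fin n → ℝ) (j : Fin n) (c : ℝ), IsAlgebraic ℚ c → a j ≤ c → c ≤ b j → ∀ (r r₁ r₂ : KZ.IntegralRep (n + 1)),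 r.domain = {p : Fin (n + 1) → ℝ | (∀ j : Fin n, a j < p (Fin.castSucc j) ∧ p (Fin.castSucc j) < b j) ∧ 0 < p (Fin.last n) ∧ p (Fin.last n) * ∏ j : Fin n, p (Fin.castSucc j) < 1} → r₁.domain = {p : Fin (n + 1) → ℝ | (∀ i : Fin n, a i < p (Fin.castSucc i) ∧ p (Fin.castSucc i) < Function.update b j c i) ∧ 0 < p (Fin.last n) ∧ p (Fin.last n) * ∏ i : Fin n, p (Fin.castSucc i) < 1} → r₂.domain = {p : Fin (n + 1) → ℝ | (∀ i : Fin n, Function.update a j c i < p (Fin.castSucc i) ∧ p (Fin.castSucc i) < b i) ∧ 0 < p (Fin.last n) ∧ p (Fin.last n) * ∏ i : Fin n, p (Fin.castSucc i) < 1} → (∀ p ∈ r.domain, r.integrand p = 1) → (∀ p ∈ r₁.domain, r₁.integrand p = 1) → (∀ p ∈ r₂.domain, r₂.integrand p = 1) → KZ.of r - KZ.of r₁ - KZ.of r₂ ∈ KZ.relations)) (hScale : (∀ (n : ℕ) (a b l : Fin n → ℝ), (∀ j, 0 < l j) → (∀ j, IsAlgebraic ℚ (l j)) → ∀ (r r'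 : KZ.IntegralRep (n + 1)), r.domain = {p : Fin (n + 1) → ℝ | (∀ j : Fin n, a j < p (Fin.castSucc j) ∧ p (Fin.castSucc j) < b j) ∧ 0 < p (Fin.last n) ∧ p (Fin.last n) * ∏ j : Fin n, p (Fin.castSucc j) < 1} → r'.domain = {p : Fin (n + 1) → ℝ | (∀ j : Fin n, l j * a j < p (Fin.castSucc j) ∧ p (Fin.castSucc j) < l j * b j) ∧ 0 < p (Fin.last n) ∧ p (Fin.last n) * ∏ j : Fin n, p (Fin.castSucc j) < 1} → (∀ p ∈ r.domain, r.integrand p = 1) → (∀ p ∈ r'.domain, r'.integrand p = 1) → KZ.of r - KZ.of r' ∈ KZ.relations)) (hPerm : (∀ (n : ℕ) (a b : Fin n → ℝ) (σ : Equiv.Perm (Fin n)), ∀ (r r' : KZ.IntegralRep (n + 1)), r.domain = {p : Fin (n + 1) → ℝ | (∀ j : Fin n, a j < p (Fin.castSucc j) ∧ p (Fin.castSucc j) < b j) ∧ 0 < p (Fin.last n) ∧ p (Fin.last n) * ∏ j : Fin n, p (Fin.castSucc j) < 1} → r'.domain = {p : Fin (n + 1) → ℝ | (∀ j : Fin n,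 a (σ j) < p (Fin.castSucc j) ∧ p (Fin.castSucc j) < b (σ j)) ∧ 0 < p (Fin.last n) ∧ p (Fin.last n) * ∏ j : Fin n, p (Fin.castSucc j) < 1} → (∀ p ∈ r.domain, r.integrand p = 1) → (∀ p ∈ r'.domain, r'.integrand p = 1) → KZ.of r - KZ.of r' ∈ KZ.relations))
    (hVal : (∀ (n : ℕ) (a b : Fin n → ℝ), (∀ j, 0 < a j) → (∀ j, a j < b j) → ∀ (r : KZ.IntegralRep (n + 1)), r.domain = {p : Fin (n + 1) → ℝ | (∀ j : Fin n, a j < p (Fin.castSucc j) ∧ p (Fin.castSucc j) < b j) ∧ 0 < p (Fin.last n) ∧ p (Fin.last n) * ∏ j : Fin n, p (Fin.castSucc j) < 1} → (∀ p ∈ r.domain, r.integrand p = 1) → r.value = ∏ j : Fin n, Real.log (b j / a j))) (hGS : (∀ (α β : ℝ), 0 < α → 0 < β → IsAlgebraic ℚ α → IsAlgebraic ℚ β → (∀ p q : ℤ, α ^ p * β ^ q = 1 → p = 0 ∧ q = 0) → ∀ (d : ℕ) (c : Fin (d + 1) → ℚ), ∑ k : Fin (d + 1), (c k : ℝ) *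 Real.log α ^ (k : ℕ) * Real.log β ^ (d - (k : ℕ)) = 0 → ∀ k, c k = 0)) {n : ℕ} {α β : ℝ} (hα : 1 < α) (hβ : 1 < β)
    (hαa : IsAlgebraic ℚ α) (hβa : IsAlgebraic ℚ β)
    (hind : ∀ p q : ℤ, α ^ p * β ^ q = 1 → p = 0 ∧ q = 0)
    {k k' : ℕ} (u v u₁ v₁ : Fin k → Fin n → ℤ) (s t s₁ t₁ : Fin k' → Fin n → ℤ)
    (r : Fin k → KZ.IntegralRep (n + 1)) (r' : Fin k' → KZ.IntegralRep (n + 1))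
    (hlt : ∀ i j, α ^ u i j * β ^ v i j < α ^ u₁ i j * β ^ v₁ i j)
    (hlt' : ∀ i j, α ^ s i j * β ^ t i j < α ^ s₁ i j * β ^ t₁ i j)
    (hrd : ∀ i, (r i).domain = {ξ : Fin (n + 1) → ℝ | (∀ ι : Fin n, (fun j => α ^ u i j * β ^ v i j) ι < ξ (Fin.castSucc ι) ∧ ξ (Fin.castSucc ι) < (fun j => α ^ u₁ i j * β ^ v₁ i j) ι) ∧ 0 < ξ (Fin.last n) ∧ ξ (Fin.last n) * ∏ ι : Fin n, ξ (Fin.castSucc ι) < 1})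
    (hr : ∀ i, ∀ x ∈ (r i).domain, (r i).integrand x = 1)
    (hrd' : ∀ i, (r' i).domain = {ξ : Fin (n + 1) → ℝ | (∀ ι : Fin n, (fun j => α ^ s i j * β ^ t i j) ι < ξ (Fin.castSucc ι) ∧ ξ (Fin.castSucc ι) < (fun j => α ^ s₁ i j * β ^ t₁ i j) ι) ∧ 0 < ξ (Fin.last n) ∧ ξ (Fin.last n) * ∏ ι : Fin n, ξ (Fin.castSucc ι) < 1})
    (hr' : ∀ i, ∀ x ∈ (r' i).domain, (r' i).integrand x = 1)
    (hv : ∑ i, (r i).value = ∑ i, (r' i).value) :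
    ∑ i, KZ.of (r i) - ∑ i, KZ.of (r' i) ∈ KZ.relations := by
  have hα0 : 0 < α := one_pos.trans hα
  have hβ0 : 0 < β := one_pos.trans hβ
  -- the unit family
  have hca : ∀ (w : Fin n → Bool) (j : Fin n), IsAlgebraic ℚ (if w j = true then β else α) := by
    intro w j; cases w j <;> simpa
  choose U hUd hUi using fun w : Fin n → Bool => hEx n (fun _ => (1:ℝ))
    (fun j => if w j = true then β else α) (fun _ => one_pos) (fun _ => isAlgebraic_one) (hca w)
  have hU : ∀ w, ∀ x ∈ (U w).domain, (U w).integrand x = 1 := fun w x _ => by rw [hUi w]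
  -- letter count and the collected unit classes
  have hW : ∃ W : Fin (n + 1) → KZ.FormalRep ⧸ KZ.relations, ∀ w, (QuotientAddGroup.mk' KZ.relations) (KZ.of (U w)) = W ((fun w : Fin n → Bool => (⟨(Finset.univ.filter fun j => w j = false).card, toric_count_lt w⟩ : Fin (n + 1))) w) := by
    classical
    refine ⟨fun kk => if h : ∃ w : Fin n → Bool, (Finset.univ.filter fun j => w j = false).card = (kk : ℕ)
      then (QuotientAddGroup.mk' KZ.relations) (KZ.of (U h.choose)) else 0, fun w => ?_⟩
    have h : ∃ w' : Fin n → Bool, (Finset.univ.filter fun j => w' j = false).card =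
        (Finset.univ.filter fun j => w j = false).card := ⟨w, rfl⟩
    beta_reduce
    rw [Fin.val_mk, dif_pos h]
    exact toric_unit_class_eq hPerm U hUd hU w h.choose h.choose_spec.symm
  obtain ⟨W, hVW⟩ := hW
  -- the class of one box of each family
  have hclass : ∀ (m : ℕ) (uu vv uu₁ vv₁ : Fin m → Fin n → ℤ) (rr : Fin m → KZ.IntegralRep (n + 1)),
      (∀ i j, α ^ uu i j * β ^ vv i j < α ^ uu₁ i j * β ^ vv₁ i j) →
      (∀ i, (rr i).domain = {ξ : Fin (n + 1) → ℝ | (∀ ι : Fin n, (fun j => α ^ uu i j * β ^ vv i j) ι < ξ (Fin.castSucc ι) ∧ ξ (Fin.castSucc ι) < (fun j => α ^ uu₁ i j * β ^ vv₁ i j) ι) ∧ 0 < ξ (Fin.last n) ∧ ξ (Fin.last n) * ∏ ι : Fin n, ξ (Fin.castSucc ι) < 1}) →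
      (∀ i, ∀ x ∈ (rr i).domain, (rr i).integrand x = 1) →
      ∀ i, (QuotientAddGroup.mk' KZ.relations) (KZ.of (rr i)) = ∑ w : Fin n → Bool,
        (∏ j, (if w j = true then (vv₁ i j - vv i j) else (uu₁ i j - uu i j))) • (QuotientAddGroup.mk' KZ.relations) (KZ.of (U w)) := by
    intro m uu vv uu₁ vv₁ rr hlt hrd hr i
    have hpq : ∀ j, 1 < α ^ (uu₁ i j - uu i j) * β ^ (vv₁ i j - vv i j) :=
      fun j => toric_one_lt_corner_div hα0 hβ0 (hlt i j)
    -- the origin box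
    obtain ⟨o, hod, hoi⟩ := hEx n (fun _ => (1:ℝ))
      (fun j => α ^ (uu₁ i j - uu i j) * β ^ (vv₁ i j - vv i j)) (fun _ => one_pos)
      (fun _ => isAlgebraic_one)
      (fun j => (toric_isAlgebraic_zpow hαa _).mul (toric_isAlgebraic_zpow hβa _))
    have hoi' : ∀ x ∈ o.domain, o.integrand x = 1 := fun x _ => by rw [hoi]
    have hpos : ∀ j, 0 < α ^ uu i j * β ^ vv i j :=
      fun j => mul_pos (zpow_pos hα0 _) (zpow_pos hβ0 _)
    have h₁ : (QuotientAddGroup.mk' KZ.relations) (KZ.of (rr i)) = (QuotientAddGroup.mk' KZ.relations) (KZ.of o) := by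
      refine toric_rescale hEx hScale (fun j => (α ^ uu i j * β ^ vv i j)⁻¹)
        (fun j => inv_pos.mpr (hpos j))
        (fun j => ((toric_isAlgebraic_zpow hαa _).mul (toric_isAlgebraic_zpow hβa _)).inv)
        hpos (fun j => (toric_isAlgebraic_zpow hαa _).mul (toric_isAlgebraic_zpow hβa _))
        (fun j => (toric_isAlgebraic_zpow hαa _).mul (toric_isAlgebraic_zpow hβa _))
        (rr i) (hrd i) (hr i) (fun j => inv_mul_cancel₀ (hpos j).ne')
        (fun j => toric_corner_div hα0 hβ0 _ _ _ _) o hod hoi'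
    rw [h₁]
    exact toric_expand hEx hCut hScale hα hβ hαa hβa U hUd hU _ _ hpq o hod hoi'
  -- collected coefficients
  set C : Fin (n + 1) → ℤ := fun kk => ∑ i : Fin k, ∑ w ∈ Finset.univ.filter (fun w => (fun w : Fin n → Bool => (⟨(Finset.univ.filter fun j => w j = false).card, toric_count_lt w⟩ : Fin (n + 1))) w = kk),
    ∏ j, (if w j = true then (v₁ i j - v i j) else (u₁ i j - u i j)) with hC
  set C' : Fin (n + 1) → ℤ := fun kk => ∑ i : Fin k', ∑ w ∈ Finset.univ.filter (fun w => (fun w : Fin n → Bool => (⟨(Finset.univ.filter fun j => w j = false).card, toric_count_lt w⟩ : Fin (n + 1))) w = kk),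
    ∏ j, (if w j = true then (t₁ i j - t i j) else (s₁ i j - s i j)) with hC'
  have hsum : (QuotientAddGroup.mk' KZ.relations) (∑ i, KZ.of (r i)) = ∑ kk, C kk • W kk := by
    rw [map_sum]
    simp_rw [hclass k u v u₁ v₁ r hlt hrd hr,
      fun i => toric_collect (fun w => ∏ j, (if w j = true then (v₁ i j - v i j) else (u₁ i j - u i j)))
        (fun w => (QuotientAddGroup.mk' KZ.relations) (KZ.of (U w))) W (fun w : Fin n → Bool => (⟨(Finset.univ.filter fun j => w j = false).card, toric_count_lt w⟩ : Fin (n + 1))) hVW]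
    rw [Finset.sum_comm]
    refine Finset.sum_congr rfl fun kk _ => ?_
    rw [hC, Finset.sum_smul]
  have hsum' : (QuotientAddGroup.mk' KZ.relations) (∑ i, KZ.of (r' i)) = ∑ kk, C' kk • W kk := by
    rw [map_sum]
    simp_rw [hclass k' s t s₁ t₁ r' hlt' hrd' hr',
      fun i => toric_collect (fun w => ∏ j, (if w j = true then (t₁ i j - t i j) else (s₁ i j - s i j)))
        (fun w => (QuotientAddGroup.mk' KZ.relations) (KZ.of (U w))) W (fun w : Fin n → Bool => (⟨(Finset.univ.filter fun j => w j = false).card, toric_count_lt w⟩ : Fin (n + 1))) hVW]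
    rw [Finset.sum_comm]
    refine Finset.sum_congr rfl fun kk _ => ?_
    rw [hC', Finset.sum_smul]
  -- values
  set X : ℝ := Real.log α with hX
  set Y : ℝ := Real.log β with hY
  have hvalue : ∀ (m : ℕ) (uu vv uu₁ vv₁ : Fin m → Fin n → ℤ) (rr : Fin m → KZ.IntegralRep (n + 1)),
      (∀ i j, α ^ uu i j * β ^ vv i j < α ^ uu₁ i j * β ^ vv₁ i j) →
      (∀ i, (rr i).domain = {ξ : Fin (n + 1) → ℝ | (∀ ι : Fin n, (fun j => α ^ uu i j * β ^ vv i j) ι < ξ (Fin.castSucc ι) ∧ ξ (Fin.castSucc ι) < (fun j => α ^ uu₁ i j * β ^ vv₁ i j) ι) ∧ 0 < ξ (Fin.last n) ∧ ξ (Fin.last n) * ∏ ι : Fin n, ξ (Fin.castSucc ι) < 1}) →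
      (∀ i, ∀ x ∈ (rr i).domain, (rr i).integrand x = 1) →
      ∑ i, (rr i).value = ∑ kk : Fin (n + 1), ((∑ i : Fin m, ∑ w ∈ Finset.univ.filter (fun w => (fun w : Fin n → Bool => (⟨(Finset.univ.filter fun j => w j = false).card, toric_count_lt w⟩ : Fin (n + 1))) w = kk),
        ∏ j, (if w j = true then (vv₁ i j - vv i j) else (uu₁ i j - uu i j)) : ℤ) : ℝ) *
        X ^ (kk : ℕ) * Y ^ (n - (kk : ℕ)) := by
    intro m uu vv uu₁ vv₁ rr hlt hrd hr
    have hvi : ∀ i, (rr i).value = ∑ kk : Fin (n + 1), ((∑ w ∈ Finset.univ.filter (fun w => (fun w : Fin n → Bool => (⟨(Finset.univ.filter fun j => w j = false).card, toric_count_lt w⟩ : Fin (n + 1))) w = kk),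
        ∏ j, (if w j = true then (vv₁ i j - vv i j) else (uu₁ i j - uu i j)) : ℤ) : ℝ) *
        (X ^ (kk : ℕ) * Y ^ (n - (kk : ℕ))) := by
      intro i
      rw [toric_value hVal hα0 hβ0 (uu i) (vv i) (uu₁ i) (vv₁ i) (hlt i) (rr i) (hrd i) (hr i)]
      have hc := toric_collect (G := ℝ)
        (fun w => ∏ j, (if w j = true then (vv₁ i j - vv i j) else (uu₁ i j - uu i j)))
        (fun w => X ^ (Finset.univ.filter fun j => w j = false).card *
          Y ^ (n - (Finset.univ.filter fun j => w j = false).card))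
        (fun kk => X ^ (kk : ℕ) * Y ^ (n - (kk : ℕ))) (fun w : Fin n → Bool => (⟨(Finset.univ.filter fun j => w j = false).card, toric_count_lt w⟩ : Fin (n + 1))) (fun w => rfl)
      simp only [zsmul_eq_mul] at hc
      simpa only [mul_assoc, Int.cast_sum] using hc
    simp_rw [hvi]
    rw [Finset.sum_comm]
    refine Finset.sum_congr rfl fun kk _ => ?_
    rw [Int.cast_sum, Finset.sum_mul, Finset.sum_mul]
    refine Finset.sum_congr rfl fun i _ => ?_
    ring
  have hv₁ := hvalue k u v u₁ v₁ r hlt hrd hr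
  have hv₂ := hvalue k' s t s₁ t₁ r' hlt' hrd' hr'
  -- equal values force equal collected coefficients
  have hCC : ∀ kk, C kk = C' kk := by
    have hzero : ∑ kk : Fin (n + 1), (((fun kk => ((C kk - C' kk : ℤ) : ℚ)) kk : ℝ)) *
        Real.log α ^ (kk : ℕ) * Real.log β ^ (n - (kk : ℕ)) = 0 := by
      have : ∑ kk : Fin (n + 1), ((C kk : ℝ) * X ^ (kk : ℕ) * Y ^ (n - (kk : ℕ)) -
          (C' kk : ℝ) * X ^ (kk : ℕ) * Y ^ (n - (kk : ℕ))) = 0 := by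
        rw [Finset.sum_sub_distrib, sub_eq_zero, hC, hC']
        exact hv₁.symm.trans (hv.trans hv₂)
      rw [← this]
      refine Finset.sum_congr rfl fun kk _ => ?_
      push_cast
      ring
    intro kk
    have h := hGS α β hα0 hβ0 hαa hβa hind n (fun kk => ((C kk - C' kk : ℤ) : ℚ)) hzero kk
    have h' : ((C kk - C' kk : ℤ) : ℚ) = 0 := h
    exact_mod_cast sub_eq_zero.mp (by exact_mod_cast h' : (C kk - C' kk : ℤ) = 0)
  -- conclude
  refine toric_mk_eq_iff.mp ?_
  rw [hsum, hsum']
  exact Finset.sum_congr rfl fun kk _ => by rw [hCC kk]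

/-! ## Removing the normalisation `α, β > 1` -/

/-- The core in the shape of the sector statement, bases `> 1`. [folklore] -/
theorem toric_rest_of_one_lt (hEx : (∀ (n : ℕ) (a b : Fin n → ℝ), (∀ j, 0 < a j) → (∀ j, IsAlgebraic ℚ (a j)) → (∀ j, IsAlgebraic ℚ (b j)) → ∃ r : KZ.IntegralRep (n + 1), r.domain = {p : Fin (n + 1) → ℝ | (∀ j : Fin n, a j < p (Fin.castSucc j) ∧ p (Fin.castSucc j) < b j) ∧ 0 < p (Fin.last n) ∧ p (Fin.last n) * ∏ j : Fin n, p (Fin.castSucc j) < 1} ∧ r.integrand = fun _ => 1)) (hCut : (∀ (n : ℕ) (a b : Fin n → ℝ) (j : Fin n) (c : ℝ), IsAlgebraic ℚ c → a j ≤ c → c ≤ b j → ∀ (r r₁ r₂ : KZ.IntegralRep (n + 1)), r.domain = {p : Fin (n + 1) → ℝ | (∀ j : Fin n, a j < p (Fin.castSucc j) ∧ p (Fin.castSucc j) < b j) ∧ 0 < p (Fin.last n) ∧ p (Fin.last n) * ∏ j : Fin n, p (Fin.castSucc j) < 1} → r₁.domain = {p : Fin (n + 1) → ℝ | (∀ i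 : Fin n, a i < p (Fin.castSucc i) ∧ p (Fin.castSucc i) < Function.update b j c i) ∧ 0 < p (Fin.last n) ∧ p (Fin.last n) * ∏ i : Fin n, p (Fin.castSucc i) < 1} → r₂.domain = {p : Fin (n + 1) → ℝ | (∀ i : Fin n, Function.update a j c i < p (Fin.castSucc i) ∧ p (Fin.castSucc i) < b i) ∧ 0 < p (Fin.last n) ∧ p (Fin.last n) * ∏ i : Fin n, p (Fin.castSucc i) < 1} → (∀ p ∈ r.domain, r.integrand p = 1) → (∀ p ∈ r₁.domain, r₁.integrand p = 1) → (∀ p ∈ r₂.domain, r₂.integrand p = 1) → KZ.of r - KZ.of r₁ - KZ.of r₂ ∈ KZ.relations)) (hScale : (∀ (n : ℕ) (a b l : Fin n → ℝ), (∀ j, 0 < l j) → (∀ j, IsAlgebraic ℚ (l j)) → ∀ (r r' : KZ.IntegralRep (n + 1)), r.domain = {p : Fin (n + 1) → ℝ | (∀ j : Fin n, a j < p (Fin.castSucc j) ∧ p (Fin.castSucc j) < b j) ∧ 0 < p (Fin.last n) ∧ p (Fin.last n) * ∏ j : Fin n, p (Fin.castSucc j) < 1} → r'.domain = {p : Fin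 (n + 1) → ℝ | (∀ j : Fin n, l j * a j < p (Fin.castSucc j) ∧ p (Fin.castSucc j) < l j * b j) ∧ 0 < p (Fin.last n) ∧ p (Fin.last n) * ∏ j : Fin n, p (Fin.castSucc j) < 1} → (∀ p ∈ r.domain, r.integrand p = 1) → (∀ p ∈ r'.domain, r'.integrand p = 1) → KZ.of r - KZ.of r' ∈ KZ.relations)) (hPerm : (∀ (n : ℕ) (a b : Fin n → ℝ) (σ : Equiv.Perm (Fin n)), ∀ (r r' : KZ.IntegralRep (n + 1)), r.domain = {p : Fin (n + 1) → ℝ | (∀ j : Fin n, a j < p (Fin.castSucc j) ∧ p (Fin.castSucc j) < b j) ∧ 0 < p (Fin.last n) ∧ p (Fin.last n) * ∏ j : Fin n, p (Fin.castSucc j) < 1} → r'.domain = {p : Fin (n + 1) → ℝ | (∀ j : Fin n, a (σ j) < p (Fin.castSucc j) ∧ p (Fin.castSucc j) < b (σ j)) ∧ 0 < p (Fin.last n) ∧ p (Fin.last n) * ∏ j : Fin n, p (Fin.castSucc j) < 1} → (∀ p ∈ r.domain, r.integrand p = 1) → (∀ p ∈ r'.domain, r'.integrand p = 1) → KZ.of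 r - KZ.of r' ∈ KZ.relations))
    (hVal : (∀ (n : ℕ) (a b : Fin n → ℝ), (∀ j, 0 < a j) → (∀ j, a j < b j) → ∀ (r : KZ.IntegralRep (n + 1)), r.domain = {p : Fin (n + 1) → ℝ | (∀ j : Fin n, a j < p (Fin.castSucc j) ∧ p (Fin.castSucc j) < b j) ∧ 0 < p (Fin.last n) ∧ p (Fin.last n) * ∏ j : Fin n, p (Fin.castSucc j) < 1} → (∀ p ∈ r.domain, r.integrand p = 1) → r.value = ∏ j : Fin n, Real.log (b j / a j))) (hGS : (∀ (α β : ℝ), 0 < α → 0 < β → IsAlgebraic ℚ α → IsAlgebraic ℚ β → (∀ p q : ℤ, α ^ p * β ^ q = 1 → p = 0 ∧ q = 0) → ∀ (d : ℕ) (c : Fin (d + 1) → ℚ), ∑ k : Fin (d + 1), (c k : ℝ) * Real.log α ^ (k : ℕ) * Real.log β ^ (d - (k : ℕ)) = 0 → ∀ k, c k = 0)) (n : ℕ) (α β : ℝ) (hα : 1 < α) (hβ : 1 < β)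
    (hαa : IsAlgebraic ℚ α) (hβa : IsAlgebraic ℚ β)
    (hind : ∀ p q : ℤ, α ^ p * β ^ q = 1 → p = 0 ∧ q = 0) : (∀ (k k' : ℕ) (u v u₁ v₁ : Fin k → Fin n → ℤ) (s t s₁ t₁ : Fin k' → Fin n → ℤ) (r : Fin k → KZ.IntegralRep (n + 1)) (r' : Fin k' → KZ.IntegralRep (n + 1)), (∀ i j, (α) ^ u i j * (β) ^ v i j < (α) ^ u₁ i j * (β) ^ v₁ i j) → (∀ i j, (α) ^ s i j * (β) ^ t i j < (α) ^ s₁ i j * (β) ^ t₁ i j) → (∀ i, (r i).domain = {p : Fin (n + 1) → ℝ | (∀ j : Fin n, (α) ^ u i j * (β) ^ v i j < p (Fin.castSucc j) ∧ p (Fin.castSucc j) < (α) ^ u₁ i j * (β) ^ v₁ i j) ∧ 0 < p (Fin.last n) ∧ p (Fin.last n) * ∏ j : Fin n, p (Fin.castSucc j) < 1}) → (∀ i, ∀ p ∈ (r i).domain, (r i).integrand p = 1) → (∀ i, (r' i).domain = {p : Fin (n + 1) → ℝ | (∀ j : Fin n, (α) ^ s i j * (β) ^ t i j < p (Fin.castSucc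 j) ∧ p (Fin.castSucc j) < (α) ^ s₁ i j * (β) ^ t₁ i j) ∧ 0 < p (Fin.last n) ∧ p (Fin.last n) * ∏ j : Fin n, p (Fin.castSucc j) < 1}) → (∀ i, ∀ p ∈ (r' i).domain, (r' i).integrand p = 1) → ∑ i, (r i).value = ∑ i, (r' i).value → ∑ i, KZ.of (r i) - ∑ i, KZ.of (r' i) ∈ KZ.relations) := by
  intro k k' u v u₁ v₁ s t s₁ t₁ r r' hlt hlt' hrd hr hrd' hr' hv
  exact toric_core hEx hCut hScale hPerm hVal hGS hα hβ hαa hβa hind u v u₁ v₁ s t s₁ t₁ r r'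
    hlt hlt' hrd hr hrd' hr' hv

/-- Independence transfers to the inverted first base. [folklore] -/
theorem toric_indep_inv_left {α β : ℝ} (hind : ∀ p q : ℤ, α ^ p * β ^ q = 1 → p = 0 ∧ q = 0) :
    ∀ p q : ℤ, α⁻¹ ^ p * β ^ q = 1 → p = 0 ∧ q = 0 := by
  intro p q h
  rw [inv_zpow'] at h
  have := hind (-p) q h
  omega

/-- Independence transfers to the inverted second base. [folklore] -/
theorem toric_indep_inv_right {α β : ℝ} (hind : ∀ p q : ℤ, α ^ p * β ^ q = 1 → p = 0 ∧ q = 0) :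
    ∀ p q : ℤ, α ^ p * β⁻¹ ^ q = 1 → p = 0 ∧ q = 0 := by
  intro p q h
  rw [inv_zpow'] at h
  have := hind p (-q) h
  omega

/-- Flipping the first base: the sector statement for `(α⁻¹, β)` gives it for `(α, β)`
(negate the `α`-exponents). [folklore] -/
theorem toric_flip_left (n : ℕ) (α β : ℝ) (H : (∀ (k k' : ℕ) (u v u₁ v₁ : Fin k → Fin n → ℤ) (s t s₁ t₁ : Fin k' → Fin n → ℤ) (r : Fin k → KZ.IntegralRep (n + 1)) (r' : Fin k' → KZ.IntegralRep (n + 1)), (∀ i j, (α⁻¹) ^ u i j * (β) ^ v i j < (α⁻¹) ^ u₁ i j * (β) ^ v₁ i j) → (∀ i j, (α⁻¹) ^ s i j * (β) ^ t i j < (α⁻¹) ^ s₁ i j * (β) ^ t₁ i j) → (∀ i, (r i).domain = {p : Fin (n + 1) → ℝ | (∀ j : Fin n, (α⁻¹) ^ u i j * (β) ^ v i j < p (Fin.castSucc j) ∧ p (Fin.castSucc j) < (α⁻¹) ^ u₁ i j * (β) ^ v₁ i j) ∧ 0 < p (Fin.last n) ∧ p (Fin.last n) * ∏ j : Fin n,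 p (Fin.castSucc j) < 1}) → (∀ i, ∀ p ∈ (r i).domain, (r i).integrand p = 1) → (∀ i, (r' i).domain = {p : Fin (n + 1) → ℝ | (∀ j : Fin n, (α⁻¹) ^ s i j * (β) ^ t i j < p (Fin.castSucc j) ∧ p (Fin.castSucc j) < (α⁻¹) ^ s₁ i j * (β) ^ t₁ i j) ∧ 0 < p (Fin.last n) ∧ p (Fin.last n) * ∏ j : Fin n, p (Fin.castSucc j) < 1}) → (∀ i, ∀ p ∈ (r' i).domain, (r' i).integrand p = 1) → ∑ i, (r i).value = ∑ i, (r' i).value → ∑ i, KZ.of (r i) - ∑ i, KZ.of (r' i) ∈ KZ.relations)) : (∀ (k k' : ℕ) (u v u₁ v₁ : Fin k → Fin n → ℤ) (s t s₁ t₁ : Fin k' → Fin n → ℤ) (r : Fin k → KZ.IntegralRep (n + 1)) (r' : Fin k' → KZ.IntegralRep (n + 1)), (∀ i j, (α) ^ u i j * (β) ^ v i j < (α) ^ u₁ i j * (β) ^ v₁ i j) → (∀ i j, (α) ^ s i j * (β) ^ t i j < (α) ^ s₁ i j * (β) ^ t₁ i j) → (∀ i, (r i).domain = {p : Fin (n +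 1) → ℝ | (∀ j : Fin n, (α) ^ u i j * (β) ^ v i j < p (Fin.castSucc j) ∧ p (Fin.castSucc j) < (α) ^ u₁ i j * (β) ^ v₁ i j) ∧ 0 < p (Fin.last n) ∧ p (Fin.last n) * ∏ j : Fin n, p (Fin.castSucc j) < 1}) → (∀ i, ∀ p ∈ (r i).domain, (r i).integrand p = 1) → (∀ i, (r' i).domain = {p : Fin (n + 1) → ℝ | (∀ j : Fin n, (α) ^ s i j * (β) ^ t i j < p (Fin.castSucc j) ∧ p (Fin.castSucc j) < (α) ^ s₁ i j * (β) ^ t₁ i j) ∧ 0 < p (Fin.last n) ∧ p (Fin.last n) * ∏ j : Fin n, p (Fin.castSucc j) < 1}) → (∀ i, ∀ p ∈ (r' i).domain, (r' i).integrand p = 1) → ∑ i, (r i).value = ∑ i, (r' i).value → ∑ i, KZ.of (r i) - ∑ i, KZ.of (r' i) ∈ KZ.relations) := by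
  intro k k' u v u₁ v₁ s t s₁ t₁ r r' hlt hlt' hrd hr hrd' hr' hv
  refine H k k' (fun i j => - u i j) v (fun i j => - u₁ i j) v₁ (fun i j => - s i j) t
    (fun i j => - s₁ i j) t₁ r r' ?_ ?_ ?_ hr ?_ hr' hv
  · intro i j; simpa only [inv_zpow', neg_neg] using hlt i j
  · intro i j; simpa only [inv_zpow', neg_neg] using hlt' i j
  · intro i; simpa only [inv_zpow', neg_neg] using hrd i
  · intro i; simpa only [inv_zpow', neg_neg] using hrd' i

/-- Flipping the second base. [folklore] -/
theorem toric_flip_right (n : ℕ) (α β : ℝ) (H : (∀ (k k' : ℕ) (u v u₁ v₁ : Fin k → Fin n → ℤ) (s t s₁ t₁ : Fin k' → Fin n → ℤ) (r : Fin k → KZ.IntegralRep (n + 1)) (r' : Fin k' → KZ.IntegralRep (n + 1)), (∀ i j, (α) ^ u i j * (β⁻¹) ^ v i j < (α) ^ u₁ i j * (β⁻¹) ^ v₁ i j) → (∀ i j, (α) ^ s i j * (β⁻¹) ^ t i j < (α) ^ s₁ i j * (β⁻¹) ^ t₁ i j) → (∀ i, (r i).domain = {p : Fin (n + 1) → ℝ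 | (∀ j : Fin n, (α) ^ u i j * (β⁻¹) ^ v i j < p (Fin.castSucc j) ∧ p (Fin.castSucc j) < (α) ^ u₁ i j * (β⁻¹) ^ v₁ i j) ∧ 0 < p (Fin.last n) ∧ p (Fin.last n) * ∏ j : Fin n, p (Fin.castSucc j) < 1}) → (∀ i, ∀ p ∈ (r i).domain, (r i).integrand p = 1) → (∀ i, (r' i).domain = {p : Fin (n + 1) → ℝ | (∀ j : Fin n, (α) ^ s i j * (β⁻¹) ^ t i j < p (Fin.castSucc j) ∧ p (Fin.castSucc j) < (α) ^ s₁ i j * (β⁻¹) ^ t₁ i j) ∧ 0 < p (Fin.last n) ∧ p (Fin.last n) * ∏ j : Fin n, p (Fin.castSucc j) < 1}) → (∀ i, ∀ p ∈ (r' i).domain, (r' i).integrand p = 1) → ∑ i, (r i).value = ∑ i, (r' i).value → ∑ i, KZ.of (r i) - ∑ i, KZ.of (r' i) ∈ KZ.relations)) : (∀ (k k' : ℕ) (u v u₁ v₁ : Fin k → Fin n → ℤ) (s t s₁ t₁ : Fin k' → Fin n → ℤ) (r : Fin k → KZ.IntegralRep (n + 1)) (r' : Fin k' → KZ.IntegralRep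 (n + 1)), (∀ i j, (α) ^ u i j * (β) ^ v i j < (α) ^ u₁ i j * (β) ^ v₁ i j) → (∀ i j, (α) ^ s i j * (β) ^ t i j < (α) ^ s₁ i j * (β) ^ t₁ i j) → (∀ i, (r i).domain = {p : Fin (n + 1) → ℝ | (∀ j : Fin n, (α) ^ u i j * (β) ^ v i j < p (Fin.castSucc j) ∧ p (Fin.castSucc j) < (α) ^ u₁ i j * (β) ^ v₁ i j) ∧ 0 < p (Fin.last n) ∧ p (Fin.last n) * ∏ j : Fin n, p (Fin.castSucc j) < 1}) → (∀ i, ∀ p ∈ (r i).domain, (r i).integrand p = 1) → (∀ i, (r' i).domain = {p : Fin (n + 1) → ℝ | (∀ j : Fin n, (α) ^ s i j * (β) ^ t i j < p (Fin.castSucc j) ∧ p (Fin.castSucc j) < (α) ^ s₁ i j * (β) ^ t₁ i j) ∧ 0 < p (Fin.last n) ∧ p (Fin.last n) * ∏ j : Fin n, p (Fin.castSucc j) < 1}) → (∀ i, ∀ p ∈ (r' i).domain, (r' i).integrand p = 1) → ∑ i, (r i).value = ∑ i, (r' i).value → ∑ i, KZ.of (r i) - ∑ i, KZ.of (r' i)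 ∈ KZ.relations) := by
  intro k k' u v u₁ v₁ s t s₁ t₁ r r' hlt hlt' hrd hr hrd' hr' hv
  refine H k k' u (fun i j => - v i j) u₁ (fun i j => - v₁ i j) s (fun i j => - t i j) s₁
    (fun i j => - t₁ i j) r r' ?_ ?_ ?_ hr ?_ hr' hv
  · intro i j; simpa only [inv_zpow', neg_neg] using hlt i j
  · intro i j; simpa only [inv_zpow', neg_neg] using hlt' i j
  · intro i; simpa only [inv_zpow', neg_neg] using hrd i
  · intro i; simpa only [inv_zpow', neg_neg] using hrd' i

/-- **The rank-two toric box sector** from the six hypotheses of the stub. [folklore] -/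
theorem toric_rtb (hEx : (∀ (n : ℕ) (a b : Fin n → ℝ), (∀ j, 0 < a j) → (∀ j, IsAlgebraic ℚ (a j)) → (∀ j, IsAlgebraic ℚ (b j)) → ∃ r : KZ.IntegralRep (n + 1), r.domain = {p : Fin (n + 1) → ℝ | (∀ j : Fin n, a j < p (Fin.castSucc j) ∧ p (Fin.castSucc j) < b j) ∧ 0 < p (Fin.last n) ∧ p (Fin.last n) * ∏ j : Fin n, p (Fin.castSucc j) < 1} ∧ r.integrand = fun _ => 1)) (hCut : (∀ (n : ℕ) (a b : Fin n → ℝ) (j : Fin n) (c : ℝ), IsAlgebraic ℚ c → a j ≤ c → c ≤ b j → ∀ (r r₁ r₂ : KZ.IntegralRep (n + 1)), r.domain = {p : Fin (n + 1) → ℝ | (∀ j : Fin n, a j < p (Fin.castSucc j) ∧ p (Fin.castSucc j) < b j) ∧ 0 < p (Fin.last n) ∧ p (Fin.last n) * ∏ j : Fin n, p (Fin.castSucc j) < 1} → r₁.domain = {p : Fin (n + 1) → ℝ | (∀ i : Fin n, a i < p (Fin.castSucc i) ∧ p (Fin.castSucc i) < Function.update b j c i) ∧ 0 < p (Fin.last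 n) ∧ p (Fin.last n) * ∏ i : Fin n, p (Fin.castSucc i) < 1} → r₂.domain = {p : Fin (n + 1) → ℝ | (∀ i : Fin n, Function.update a j c i < p (Fin.castSucc i) ∧ p (Fin.castSucc i) < b i) ∧ 0 < p (Fin.last n) ∧ p (Fin.last n) * ∏ i : Fin n, p (Fin.castSucc i) < 1} → (∀ p ∈ r.domain, r.integrand p = 1) → (∀ p ∈ r₁.domain, r₁.integrand p = 1) → (∀ p ∈ r₂.domain, r₂.integrand p = 1) → KZ.of r - KZ.of r₁ - KZ.of r₂ ∈ KZ.relations)) (hScale : (∀ (n : ℕ) (a b l : Fin n → ℝ), (∀ j, 0 < l j) → (∀ j, IsAlgebraic ℚ (l j)) → ∀ (r r' : KZ.IntegralRep (n + 1)), r.domain = {p : Fin (n + 1) → ℝ | (∀ j : Fin n, a j < p (Fin.castSucc j) ∧ p (Fin.castSucc j) < b j) ∧ 0 < p (Fin.last n) ∧ p (Fin.last n) * ∏ j : Fin n, p (Fin.castSucc j) < 1} → r'.domain = {p : Fin (n + 1) → ℝ | (∀ j : Fin n, l j * a j < p (Fin.castSucc j) ∧ p (Fin.castSucc j) < l j * b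 j) ∧ 0 < p (Fin.last n) ∧ p (Fin.last n) * ∏ j : Fin n, p (Fin.castSucc j) < 1} → (∀ p ∈ r.domain, r.integrand p = 1) → (∀ p ∈ r'.domain, r'.integrand p = 1) → KZ.of r - KZ.of r' ∈ KZ.relations)) (hPerm : (∀ (n : ℕ) (a b : Fin n → ℝ) (σ : Equiv.Perm (Fin n)), ∀ (r r' : KZ.IntegralRep (n + 1)), r.domain = {p : Fin (n + 1) → ℝ | (∀ j : Fin n, a j < p (Fin.castSucc j) ∧ p (Fin.castSucc j) < b j) ∧ 0 < p (Fin.last n) ∧ p (Fin.last n) * ∏ j : Fin n, p (Fin.castSucc j) < 1} → r'.domain = {p : Fin (n + 1) → ℝ | (∀ j : Fin n, a (σ j) < p (Fin.castSucc j) ∧ p (Fin.castSucc j) < b (σ j)) ∧ 0 < p (Fin.last n) ∧ p (Fin.last n) * ∏ j : Fin n, p (Fin.castSucc j) < 1} → (∀ p ∈ r.domain, r.integrand p = 1) → (∀ p ∈ r'.domain, r'.integrand p = 1) → KZ.of r - KZ.of r' ∈ KZ.relations))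
    (hVal : (∀ (n : ℕ) (a b : Fin n → ℝ), (∀ j, 0 < a j) → (∀ j, a j < b j) → ∀ (r : KZ.IntegralRep (n + 1)), r.domain = {p : Fin (n + 1) → ℝ | (∀ j : Fin n, a j < p (Fin.castSucc j) ∧ p (Fin.castSucc j) < b j) ∧ 0 < p (Fin.last n) ∧ p (Fin.last n) * ∏ j : Fin n, p (Fin.castSucc j) < 1} → (∀ p ∈ r.domain, r.integrand p = 1) → r.value = ∏ j : Fin n, Real.log (b j / a j))) (hGS : (∀ (α β : ℝ), 0 < α → 0 < β → IsAlgebraic ℚ α → IsAlgebraic ℚ β → (∀ p q : ℤ, α ^ p * β ^ q = 1 → p = 0 ∧ q = 0) → ∀ (d : ℕ) (c : Fin (d + 1) → ℚ), ∑ k : Fin (d + 1), (c k : ℝ) * Real.log α ^ (k : ℕ) * Real.log β ^ (d - (k : ℕ)) = 0 → ∀ k, c k = 0)) : (∀ (n : ℕ) (α β : ℝ), 0 < α → 0 < β → IsAlgebraic ℚ α → IsAlgebraic ℚ β → (∀ p q : ℤ, α ^ p * β ^ q = 1 → p = 0 ∧ q = 0) → ∀ (k k' : ℕ) (u v u₁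 v₁ : Fin k → Fin n → ℤ) (s t s₁ t₁ : Fin k' → Fin n → ℤ) (r : Fin k → KZ.IntegralRep (n + 1)) (r' : Fin k' → KZ.IntegralRep (n + 1)), (∀ i j, α ^ u i j * β ^ v i j < α ^ u₁ i j * β ^ v₁ i j) → (∀ i j, α ^ s i j * β ^ t i j < α ^ s₁ i j * β ^ t₁ i j) → (∀ i, (r i).domain = {p : Fin (n + 1) → ℝ | (∀ j : Fin n, α ^ u i j * β ^ v i j < p (Fin.castSucc j) ∧ p (Fin.castSucc j) < α ^ u₁ i j * β ^ v₁ i j) ∧ 0 < p (Fin.last n) ∧ p (Fin.last n) * ∏ j : Fin n, p (Fin.castSucc j) < 1}) → (∀ i, ∀ p ∈ (r i).domain, (r i).integrand p = 1) → (∀ i, (r' i).domain = {p : Fin (n + 1) → ℝ | (∀ j : Fin n, α ^ s i j * β ^ t i j < p (Fin.castSucc j) ∧ p (Fin.castSucc j) < α ^ s₁ i j * β ^ t₁ i j) ∧ 0 < p (Fin.last n) ∧ p (Fin.last n) * ∏ j : Fin n, p (Fin.castSucc j) < 1}) → (∀ i, ∀ p ∈ (r' i).domain, (r' i).integrand p =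 1) → ∑ i, (r i).value = ∑ i, (r' i).value → ∑ i, KZ.of (r i) - ∑ i, KZ.of (r' i) ∈ KZ.relations) := by
  intro n α β hα hβ hαa hβa hind
  -- neither base is 1
  have hα1 : α ≠ 1 := by
    intro h; have := hind 1 0 (by simp [h]); omega
  have hβ1 : β ≠ 1 := by
    intro h; have := hind 0 1 (by simp [h]); omega
  have hA : ∀ (a b : ℝ), 1 < a → 1 < b → IsAlgebraic ℚ a → IsAlgebraic ℚ b →
      (∀ p q : ℤ, a ^ p * b ^ q = 1 → p = 0 ∧ q = 0) → (∀ (k k' : ℕ) (u v u₁ v₁ : Fin k → Fin n → ℤ) (s t s₁ t₁ : Fin k' → Fin n → ℤ) (r : Fin k → KZ.IntegralRep (n + 1)) (r' : Fin k' → KZ.IntegralRep (n + 1)), (∀ i j, a ^ u i j * b ^ v i j < a ^ u₁ i j * b ^ v₁ i j) → (∀ i j, a ^ s i j * b ^ t i j < a ^ s₁ i j * b ^ t₁ i j) → (∀ i, (r i).domain = {p : Fin (n + 1) → ℝ | (∀ j : Fin n, a ^ u i j * b ^ v i j < p (Fin.castSucc j) ∧ p (Fin.castSucc j) < a ^ u₁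 i j * b ^ v₁ i j) ∧ 0 < p (Fin.last n) ∧ p (Fin.last n) * ∏ j : Fin n, p (Fin.castSucc j) < 1}) → (∀ i, ∀ p ∈ (r i).domain, (r i).integrand p = 1) → (∀ i, (r' i).domain = {p : Fin (n + 1) → ℝ | (∀ j : Fin n, a ^ s i j * b ^ t i j < p (Fin.castSucc j) ∧ p (Fin.castSucc j) < a ^ s₁ i j * b ^ t₁ i j) ∧ 0 < p (Fin.last n) ∧ p (Fin.last n) * ∏ j : Fin n, p (Fin.castSucc j) < 1}) → (∀ i, ∀ p ∈ (r' i).domain, (r' i).integrand p = 1) → ∑ i, (r i).value = ∑ i, (r' i).value → ∑ i, KZ.of (r i) - ∑ i, KZ.of (r' i) ∈ KZ.relations) :=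
    fun a b ha hb haa hba hind' => toric_rest_of_one_lt hEx hCut hScale hPerm hVal hGS n a b ha hb
      haa hba hind'
  have hB : ∀ (a b : ℝ), 0 < a → a ≠ 1 → 1 < b → IsAlgebraic ℚ a → IsAlgebraic ℚ b →
      (∀ p q : ℤ, a ^ p * b ^ q = 1 → p = 0 ∧ q = 0) → (∀ (k k' : ℕ) (u v u₁ v₁ : Fin k → Fin n → ℤ) (s t s₁ t₁ : Fin k' → Fin n → ℤ) (r : Fin k → KZ.IntegralRep (n + 1)) (r' : Fin k' → KZ.IntegralRep (n + 1)), (∀ i j, a ^ u i j * b ^ v i j < a ^ u₁ i j * b ^ v₁ i j) → (∀ i j, a ^ s i j * b ^ t i j < a ^ s₁ i j * b ^ t₁ i j) → (∀ i, (r i).domain = {p : Fin (n + 1) → ℝ | (∀ j : Fin n, a ^ u i j * b ^ v i j < p (Fin.castSucc j) ∧ p (Fin.castSucc j) < a ^ u₁ i j * b ^ v₁ i j) ∧ 0 < p (Fin.last n) ∧ p (Fin.last n) * ∏ j : Fin n, p (Fin.castSucc j) < 1}) → (∀ i, ∀ p ∈ (r i).domain, (r i).integrand p = 1) → (∀ i,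 (r' i).domain = {p : Fin (n + 1) → ℝ | (∀ j : Fin n, a ^ s i j * b ^ t i j < p (Fin.castSucc j) ∧ p (Fin.castSucc j) < a ^ s₁ i j * b ^ t₁ i j) ∧ 0 < p (Fin.last n) ∧ p (Fin.last n) * ∏ j : Fin n, p (Fin.castSucc j) < 1}) → (∀ i, ∀ p ∈ (r' i).domain, (r' i).integrand p = 1) → ∑ i, (r i).value = ∑ i, (r' i).value → ∑ i, KZ.of (r i) - ∑ i, KZ.of (r' i) ∈ KZ.relations) := by
    intro a b ha ha1 hb haa hba hind'
    rcases lt_or_gt_of_ne ha1 with h | h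
    · exact toric_flip_left n a b (hA a⁻¹ b (one_lt_inv₀ ha |>.mpr h) hb haa.inv hba
        (toric_indep_inv_left hind'))
    · exact hA a b h hb haa hba hind'
  have hC : ∀ (a b : ℝ), 0 < a → a ≠ 1 → 0 < b → b ≠ 1 → IsAlgebraic ℚ a → IsAlgebraic ℚ b →
      (∀ p q : ℤ, a ^ p * b ^ q = 1 → p = 0 ∧ q = 0) → (∀ (k k' : ℕ) (u v u₁ v₁ : Fin k → Fin n → ℤ) (s t s₁ t₁ : Fin k' → Fin n → ℤ) (r : Fin k → KZ.IntegralRep (n + 1)) (r' : Fin k' → KZ.IntegralRep (n + 1)), (∀ i j, a ^ u i j * b ^ v i j < a ^ u₁ i j * b ^ v₁ i j) → (∀ i j, a ^ s i j * b ^ t i j < a ^ s₁ i j * b ^ t₁ i j) → (∀ i, (r i).domain = {p : Fin (n + 1) → ℝ | (∀ j : Fin n, a ^ u i j * b ^ v i j < p (Fin.castSucc j) ∧ p (Fin.castSucc j) < a ^ u₁ i j * b ^ v₁ i j) ∧ 0 < p (Fin.last n) ∧ p (Fin.last n) * ∏ j : Fin n, p (Fin.castSucc j) < 1}) → (∀ i,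 ∀ p ∈ (r i).domain, (r i).integrand p = 1) → (∀ i, (r' i).domain = {p : Fin (n + 1) → ℝ | (∀ j : Fin n, a ^ s i j * b ^ t i j < p (Fin.castSucc j) ∧ p (Fin.castSucc j) < a ^ s₁ i j * b ^ t₁ i j) ∧ 0 < p (Fin.last n) ∧ p (Fin.last n) * ∏ j : Fin n, p (Fin.castSucc j) < 1}) → (∀ i, ∀ p ∈ (r' i).domain, (r' i).integrand p = 1) → ∑ i, (r i).value = ∑ i, (r' i).value → ∑ i, KZ.of (r i) - ∑ i, KZ.of (r' i) ∈ KZ.relations) := by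
    intro a b ha ha1 hb hb1 haa hba hind'
    rcases lt_or_gt_of_ne hb1 with h | h
    · exact toric_flip_right n a b (hB a b⁻¹ ha ha1 (one_lt_inv₀ hb |>.mpr h) haa hba.inv
        (toric_indep_inv_right hind'))
    · exact hB a b ha ha1 h haa hba hind'
  exact hC α β hα hα1 hβ hβ1 hαa hβa hind

/-! ## The registered stub -/

/-- **Toric assembly (Hilbert's third problem for log-boxes at log-rank two).** From the value,
existence/cut, scaling/permutation and Gelfond–Schneider stubs: finite families of log-boxes with
corners in `α^ℤ β^ℤ` (`α, β` multiplicatively independent positive real algebraic) and equal total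
value are KZ-equivalent as formal sums (`toric_rtb`). [folklore] -/
theorem stub_toricAssembly :
    -- H1 = stub_logBoxValue
    (∀ (n : ℕ) (a b : Fin n → ℝ), (∀ j, 0 < a j) → (∀ j, a j < b j) →
      ∀ (r : KZ.IntegralRep (n + 1)),
      r.domain = {p : Fin (n + 1) → ℝ | (∀ j : Fin n, a j < p (Fin.castSucc j) ∧
        p (Fin.castSucc j) < b j) ∧ 0 < p (Fin.last n) ∧
        p (Fin.last n) * ∏ j : Fin n, p (Fin.castSucc j) < 1} →
      (∀ p ∈ r.domain, r.integrand p = 1) →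
      r.value = ∏ j : Fin n, Real.log (b j / a j)) →
    -- H2 = stub_logBoxCut
    ((∀ (n : ℕ) (a b : Fin n → ℝ), (∀ j, 0 < a j) → (∀ j, IsAlgebraic ℚ (a j)) →
      (∀ j, IsAlgebraic ℚ (b j)) →
      ∃ r : KZ.IntegralRep (n + 1),
        r.domain = {p : Fin (n + 1) → ℝ | (∀ j : Fin n, a j < p (Fin.castSucc j) ∧
          p (Fin.castSucc j) < b j) ∧ 0 < p (Fin.last n) ∧
          p (Fin.last n) * ∏ j : Fin n, p (Fin.castSucc j) < 1} ∧
        r.integrand = fun _ => 1) ∧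
    (∀ (n : ℕ) (a b : Fin n → ℝ) (j : Fin n) (c : ℝ), IsAlgebraic ℚ c → a j ≤ c → c ≤ b j →
      ∀ (r r₁ r₂ : KZ.IntegralRep (n + 1)),
      r.domain = {p : Fin (n + 1) → ℝ | (∀ j : Fin n, a j < p (Fin.castSucc j) ∧
        p (Fin.castSucc j) < b j) ∧ 0 < p (Fin.last n) ∧
        p (Fin.last n) * ∏ j : Fin n, p (Fin.castSucc j) < 1} →
      r₁.domain = {p : Fin (n + 1) → ℝ | (∀ i : Fin n, a i < p (Fin.castSucc i) ∧
        p (Fin.castSucc i) < Function.update b j c i) ∧ 0 < p (Fin.last n) ∧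
        p (Fin.last n) * ∏ i : Fin n, p (Fin.castSucc i) < 1} →
      r₂.domain = {p : Fin (n + 1) → ℝ | (∀ i : Fin n, Function.update a j c i < p (Fin.castSucc i) ∧
        p (Fin.castSucc i) < b i) ∧ 0 < p (Fin.last n) ∧
        p (Fin.last n) * ∏ i : Fin n, p (Fin.castSucc i) < 1} →
      (∀ p ∈ r.domain, r.integrand p = 1) → (∀ p ∈ r₁.domain, r₁.integrand p = 1) →
      (∀ p ∈ r₂.domain, r₂.integrand p = 1) →
      KZ.of r - KZ.of r₁ - KZ.of r₂ ∈ KZ.relations)) →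
    -- H3 = stub_logBoxLinear
    ((∀ (n : ℕ) (a b l : Fin n → ℝ), (∀ j, 0 < l j) → (∀ j, IsAlgebraic ℚ (l j)) →
      ∀ (r r' : KZ.IntegralRep (n + 1)),
      r.domain = {p : Fin (n + 1) → ℝ | (∀ j : Fin n, a j < p (Fin.castSucc j) ∧
        p (Fin.castSucc j) < b j) ∧ 0 < p (Fin.last n) ∧
        p (Fin.last n) * ∏ j : Fin n, p (Fin.castSucc j) < 1} →
      r'.domain = {p : Fin (n + 1) → ℝ | (∀ j : Fin n, l j * a j < p (Fin.castSucc j) ∧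
        p (Fin.castSucc j) < l j * b j) ∧ 0 < p (Fin.last n) ∧
        p (Fin.last n) * ∏ j : Fin n, p (Fin.castSucc j) < 1} →
      (∀ p ∈ r.domain, r.integrand p = 1) → (∀ p ∈ r'.domain, r'.integrand p = 1) →
      KZ.of r - KZ.of r' ∈ KZ.relations) ∧
    (∀ (n : ℕ) (a b : Fin n → ℝ) (σ : Equiv.Perm (Fin n)),
      ∀ (r r' : KZ.IntegralRep (n + 1)),
      r.domain = {p : Fin (n + 1) → ℝ | (∀ j : Fin n, a j < p (Fin.castSucc j) ∧
        p (Fin.castSucc j) < b j) ∧ 0 < p (Fin.last n) ∧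
        p (Fin.last n) * ∏ j : Fin n, p (Fin.castSucc j) < 1} →
      r'.domain = {p : Fin (n + 1) → ℝ | (∀ j : Fin n, a (σ j) < p (Fin.castSucc j) ∧
        p (Fin.castSucc j) < b (σ j)) ∧ 0 < p (Fin.last n) ∧
        p (Fin.last n) * ∏ j : Fin n, p (Fin.castSucc j) < 1} →
      (∀ p ∈ r.domain, r.integrand p = 1) → (∀ p ∈ r'.domain, r'.integrand p = 1) →
      KZ.of r - KZ.of r' ∈ KZ.relations)) →
    -- H4 = stub_rankTwoLogRatio
    (∀ (α β : ℝ), 0 < α → 0 < β → IsAlgebraic ℚ α → IsAlgebraic ℚ β →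
      (∀ p q : ℤ, α ^ p * β ^ q = 1 → p = 0 ∧ q = 0) →
      ∀ (d : ℕ) (c : Fin (d + 1) → ℚ),
      ∑ k : Fin (d + 1), (c k : ℝ) * Real.log α ^ (k : ℕ) * Real.log β ^ (d - (k : ℕ)) = 0 →
      ∀ k, c k = 0) →
    -- conclusion = the rank-two toric box sector
    ∀ (n : ℕ) (α β : ℝ), 0 < α → 0 < β → IsAlgebraic ℚ α → IsAlgebraic ℚ β →
      (∀ p q : ℤ, α ^ p * β ^ q = 1 → p = 0 ∧ q = 0) →
      ∀ (k k' : ℕ) (u v u₁ v₁ : Fin k → Fin n → ℤ) (s t s₁ t₁ : Fin k' → Fin n → ℤ)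
        (r : Fin k → KZ.IntegralRep (n + 1)) (r' : Fin k' → KZ.IntegralRep (n + 1)),
      (∀ i j, α ^ u i j * β ^ v i j < α ^ u₁ i j * β ^ v₁ i j) →
      (∀ i j, α ^ s i j * β ^ t i j < α ^ s₁ i j * β ^ t₁ i j) →
      (∀ i, (r i).domain = {p : Fin (n + 1) → ℝ | (∀ j : Fin n,
          α ^ u i j * β ^ v i j < p (Fin.castSucc j) ∧ p (Fin.castSucc j) < α ^ u₁ i j * β ^ v₁ i j) ∧
          0 < p (Fin.last n) ∧ p (Fin.last n) * ∏ j : Fin n, p (Fin.castSucc j) < 1}) →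
      (∀ i, ∀ p ∈ (r i).domain, (r i).integrand p = 1) →
      (∀ i, (r' i).domain = {p : Fin (n + 1) → ℝ | (∀ j : Fin n,
          α ^ s i j * β ^ t i j < p (Fin.castSucc j) ∧ p (Fin.castSucc j) < α ^ s₁ i j * β ^ t₁ i j) ∧
          0 < p (Fin.last n) ∧ p (Fin.last n) * ∏ j : Fin n, p (Fin.castSucc j) < 1}) →
      (∀ i, ∀ p ∈ (r' i).domain, (r' i).integrand p = 1) →
      ∑ i, (r i).value = ∑ i, (r' i).value →
      ∑ i, KZ.of (r i) - ∑ i, KZ.of (r' i) ∈ KZ.relations := by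
  intro hVal hCutEx hLin hGS
  exact toric_rtb hCutEx.1 hCutEx.2 hLin.1 hLin.2 hVal hGS

end Summit.KontsevichZagierPeriods.SymplecticScissors.LogPolytope

end
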